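import Literature.IUT.HodgeTheaters.PuncturedEllipticCoveringsCor12InertiaCentralOfCuspGalois
import Literature.IUT.HodgeTheaters.PuncturedEllipticCoveringsCuspsProofs
import Literature.IUT.HodgeTheaters.PuncturedEllipticCoveringsArrowClaimsOfLaws
import Literature.GroupTheory.CombinatorialGroupTheory.TransferConjugates
import Mathlib.GroupTheory.Transfer
import Mathlib.GroupTheory.Abelianization.Defs
import Mathlib.Tactic.Group
import HarnessLib

/-!
# [IUTchI] §1 / Cor. 1.2: the ORIENTED PRODUCT RELATION (O1) at the cusps `ε⁰, ε′, ε″` of `X̲` DERIVED by the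
# transfer `Δ_X → Δ_X̲^{ab}` — proof-only

Mochizuki, *Inter-universal Teichmüller theory I: construction of Hodge theaters*, kurims manuscript (May 2020), §1
pp. 37–38 (`Δ_X̲ ↠ Δ_X̲^{ab} ⊗ ℤ/l ↠ Δ_ε`, the cusps `ε⁰, ε′, ε″`) and Cor. 1.2 p. 39 [cite: Mochizuki2012, IUTchI §1 pp.37-39]
(D-0012 claim key; series status DISPUTED — nothing of the series is asserted here); the transfer: K. S. Brown,
*Cohomology of Groups*, III §9 [cite: Brown1982CohomologyGroups, III §9].

PROOF-ONLY file (cell abc-iut, seat abc-iut-w6-d032 gen 8; SUPPORT for abc-iut-L5-d4's row R45 / GAP-LEDGER G-L5d4g6-1;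
no `def`, no instance, no notation, no new `Prop` fact; nothing restated).  The orientation law (O1) `∃ z₀ ∈ I_{ε⁰},
z₁ ∈ I_{ε′}` (topological generator)`, z₂ ∈ I_{ε″}` with `z₀ z₁ z₂ ∈ Ker(Δ_X̲ ↠ Δ_ε)` — the binder `hprod` of abc-iut-w6-d032's
p499258, the image in `Δ_ε` of the surface relation `[α, β] · ∏_c γ_c = 1` of `Δ_X̲` — is DERIVED from (c′) at `ε⁰`
(`I_{ε⁰} = ⟨w₀⟩⁻`, `w₀ = g₀ [a, b] g₀⁻¹` with `a, b, g₀ ∈ Δ_X`; abc-iut-L5-t1's `GeomOrigin.inertia_eq_conj_commutator`), (L4)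
«`Π_X̲` centralises every `I_x` modulo `Ker(Δ_X̲ ↠ Δ_X̲^{ab} ⊗ ℤ/l)`» (`ModLCuspLaws.inertia_central`; a THEOREM of (∗) + (A) +
(c′) + the cusp action: p500241 + p501910) and the cusp action `C : D.CuspGalois` (p424023: `act_decomp`, `free`, `transitive`).
THE GROUP THEORY (`CuspGalois.exists_orientedGenerators_of_commutatorCusp`).  `Δ_X̲ ⊴ Δ_X` has finite index
(`= #Cusp(X̲)`, `Π_X = Π_X̲ · Δ_X`).  The transfer `V : Δ_X → Δ_X̲^{ab}` kills `w₀ ∈ [Δ_X, Δ_X]`, and since `w₀ ∈ Δ_X̲ ⊴ Δ_X`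
fixes every coset, `V(w₀) = ∏_{q ∈ Δ_X/Δ_X̲} s_q⁻¹ w₀ s_q` (the tree's `transfer_eq_prod_conj`).  For each coset `q`,
`act_decomp` gives `t_q ∈ Π_X̲` with `c_q := t_q s_q⁻¹` carrying `D_{ε⁰}` onto `D_{x_q}`, `x_q := s_q⁻¹ · ε⁰`; so `y_q :=
c_q w₀ c_q⁻¹` topologically generates `I_{x_q}` and `s_q⁻¹ w₀ s_q = [t_q⁻¹, y_q] · y_q ≡ y_q` modulo `Ker` by (L4).  The orbit
map `q ↦ x_q` is a bijection `Δ_X/Δ_X̲ ⥲ Cusp(X̲)` (free + transitive).  Hence `∑_x [y_x] ≡ 0` in `Δ_X̲^{ab}` modulo the image of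
`Ker(Δ_X̲ ↠ Δ_X̲^{ab} ⊗ ℤ/l)`: read modulo the nonzero cusps `≠ ε′, ε″` it is (O1) `y_{ε⁰} y_{ε′} y_{ε″} ∈ Ker(Δ_X̲ ↠ Δ_ε)`;
read at `ε⁰` it gives (REL′) `I_{ε⁰} ≤ I_{ε′} · I_{ε″} · Ker(Δ_X̲ ↠ Δ_ε)` (closure step under (L0)).  ∎
CONSEQUENCES, by name: `GeomOrigin.exists_orientedProduct (O) (C)` and `GeomOrigin.inertia_ε0_le_span (O) (C)` —
(O1) and (REL′) with NO binder beyond the origin record (A)(c′), the field (∗) and the cusp action.  With p503354 ((O2) ⟸ (N))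
and abc-iut-L5-t1's `GeomOriginIota` (p501139, p502003: (N)), the GAP binder `h0` of the [IUTchI] Cor. 1.2 closers becomes a
THEOREM of the origin records + the `Δ_ε` label laws (sequel knit); (REL′) feeds abc-iut-L5-t1's reduction of (L3)/(CS).

HONEST FRAMING: classical group theory (the transfer) about OUR typed interface; (A)/(c′) are assumption-shaped origin
binders and (∗) the datum's own hypothesis field, asserted for no instance; `C` is the interface datum of p424023; this file
DERIVES (O1), it discharges no FACT-LIST item; typed ≠ inhabited ≠ discharged; nothing here bears on [IUTchIII] Cor. 3.12
or asserts that abc is proved or refuted; no printed statement is strengthened.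
-/

noncomputable section

open Topology

namespace Literature.IUT.HodgeTheaters

namespace PuncturedEllipticData

open scoped Pointwise
open Literature.AnabelianGeometry.AbsoluteAnabelian Literature.GroupTheory.CombinatorialGroupTheory

universe u

variable {D : PuncturedEllipticData.{u}}

/-! ### §1. Plumbing -/

/-- Conjugation by a fixed element carries the closure of `⟨w⟩` into the closure of `⟨c w c⁻¹⟩` (a continuous
automorphism maps closures into closures). [folklore] -/
private theorem conj_mem_closure_zpowers_conj {P : Type*} [Group P] [TopologicalSpace P] [IsTopologicalGroup P]
    (c : P) {w u : P} (hu : u ∈ (Subgroup.zpowers w).topologicalClosure) :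
    c * u * c⁻¹ ∈ (Subgroup.zpowers (c * w * c⁻¹)).topologicalClosure := by
  have hcont : Continuous fun p : P => c * p * c⁻¹ := (continuous_const.mul continuous_id).mul continuous_const
  have himg : (fun p : P => c * p * c⁻¹) '' ((Subgroup.zpowers w : Subgroup P) : Set P) ⊆
      ((Subgroup.zpowers (c * w * c⁻¹) : Subgroup P) : Set P) := by
    rintro _ ⟨p, hp, rfl⟩
    obtain ⟨k, rfl⟩ := Subgroup.mem_zpowers_iff.mp hp
    refine Subgroup.mem_zpowers_iff.mpr ⟨k, ?_⟩
    rw [← MulAut.conj_apply, ← map_zpow, MulAut.conj_apply]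
  have hu' : u ∈ closure ((Subgroup.zpowers w : Subgroup P) : Set P) := by
    rw [← Subgroup.topologicalClosure_coe]; exact hu
  have h := image_closure_subset_closure_image hcont ⟨u, hu', rfl⟩
  change c * u * c⁻¹ ∈ ((Subgroup.zpowers (c * w * c⁻¹)).topologicalClosure : Set P)
  rw [Subgroup.topologicalClosure_coe]
  exact closure_mono himg h

/-! ### §2. (O1) by the transfer -/

namespace CuspGalois

variable (C : D.CuspGalois)

include C in
/-- **MASTER FORM — oriented cusp generators and the transfer relation**: if `I_{ε⁰}` is the closure of `⟨w₀⟩` for a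
`Δ_X`-conjugate `w₀ = g₀ [a, b] g₀⁻¹` of a commutator in `Δ_X` ((c′) at `ε⁰`) and `Π_X̲` centralises every cusp inertia group
modulo `Ker(Δ_X̲ ↠ Δ_X̲^{ab} ⊗ ℤ/l)` ((L4)), then there are topological generators `z₀` of `I_{ε⁰}`, `z₁` of `I_{ε′}` and an
element `z₂ ∈ I_{ε″}` with `z₀ z₁ z₂ ∈ Ker(Δ_X̲ ↠ Δ_ε)` and `z₀ ∈ Ker(Δ_X̲ ↠ Δ_X̲^{ab} ⊗ ℤ/l) · ∏_{x ≠ ε⁰} I_x` — the transfer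
relation `∑_x [y_x] = 0` in `Δ_X̲^{ab}` read two ways (module docstring). ([IUTchI] §1 p.38, Cor 1.2 p.39) [claim: Mochizuki2012, status: disputed] -/
theorem exists_orientedGenerators_of_commutatorCusp
    (hI0 : ∃ g ∈ D.PiX ⊓ D.DeltaC, ∃ a ∈ D.PiX ⊓ D.DeltaC, ∃ b ∈ D.PiX ⊓ D.DeltaC,
      D.inertia D.ε0 = (Subgroup.zpowers (g * (a * b * a⁻¹ * b⁻¹) * g⁻¹)).topologicalClosure)
    (hL4 : ∀ x : D.Cusp, ∀ g ∈ D.PiXbar, ∀ z ∈ D.inertia x, g * z * g⁻¹ * z⁻¹ ∈ D.modLKer) :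
    ∃ z₀ ∈ D.inertia D.ε0, ∃ z₁ ∈ D.inertia D.ε1, ∃ z₂ ∈ D.inertia D.ε2,
      (D.inertia D.ε0 ≤ (Subgroup.zpowers z₀).topologicalClosure ∧
        D.inertia D.ε1 ≤ (Subgroup.zpowers z₁).topologicalClosure) ∧
      z₀ * z₁ * z₂ ∈ D.deltaEpsKer ∧
      z₀ ∈ D.modLKer ⊔ ⨆ (x : {x : D.Cusp // x ≠ D.ε0}), D.inertia x.1 := by
  classical
  obtain ⟨g₀, hg₀, a, ha, b, hb, hI0⟩ := hI0
  -- the groups: `Δ := Δ_X ⊇ N := Δ_X̲`, `G := ↥Δ`, `H := N` viewed inside `G`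
  set Δ : Subgroup D.PiC := D.PiX ⊓ D.DeltaC with hΔdef
  set N : Subgroup D.PiC := D.DeltaXbar with hNdef
  have hNΔ : N ≤ Δ := fun p hp => ⟨(D.deltaXbar_le_piXbar hp).1, hp.2⟩
  haveI hXbarN : D.PiXbar.Normal := C.normal_PiXbar
  haveI hNn : N.Normal := by
    haveI : D.DeltaC.Normal := D.E.normal_geom
    exact Subgroup.normal_inf_normal D.PiXbar D.DeltaC
  set H : Subgroup ↥Δ := N.subgroupOf Δ with hHdef
  haveI hHn : H.Normal := ⟨fun n hn g => by
    rw [hHdef, Subgroup.mem_subgroupOf] at hn ⊢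
    rw [Subgroup.coe_mul, Subgroup.coe_mul, Subgroup.coe_inv]
    exact hNn.conj_mem _ hn _⟩
  -- finite index: `[Δ_X : Δ_X̲] = [Π_X : Π_X̲] = #Cusp`
  haveI hHfi : H.FiniteIndex := by
    refine ⟨?_⟩
    change N.relIndex Δ ≠ 0
    have h1 : N.relIndex Δ = D.PiXbar.relIndex Δ := by
      have hN' : N = D.PiXbar ⊓ Δ := by
        apply le_antisymm
        · exact le_inf D.deltaXbar_le_piXbar hNΔ
        · exact fun p hp => ⟨hp.1, hp.2.2⟩
      rw [hN', Subgroup.inf_relIndex_right]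
    have h2 : D.PiXbar.relIndex Δ = D.PiXbar.relIndex D.PiX := by
      conv_rhs => rw [D.piX_eq_piXbar_sup_deltaX]
      rw [Subgroup.relIndex_sup_left]
    rw [h1, h2, ← C.card_cusp]
    haveI := C.finite_cusp
    exact Nat.card_ne_zero.mpr ⟨⟨D.ε0⟩, inferInstance⟩
  letI := H.fintypeQuotientOfFiniteIndex
  set w₀ : D.PiC := g₀ * (a * b * a⁻¹ * b⁻¹) * g₀⁻¹ with hw₀
  have hw₀I : w₀ ∈ D.inertia D.ε0 := by rw [hI0]; exact Subgroup.le_topologicalClosure _ (Subgroup.mem_zpowers _)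
  have hw₀N : w₀ ∈ N := D.inertia_le_deltaXbar _ hw₀I
  have hw₀Δ : w₀ ∈ Δ := hNΔ hw₀N
  set wG : ↥Δ := ⟨w₀, hw₀Δ⟩ with hwG
  have hwGcomm : wG ∈ commutator ↥Δ := by
    have he : wG = ⟨g₀, hg₀⟩ * (⟨a, ha⟩ * ⟨b, hb⟩ * ⟨a, ha⟩⁻¹ * ⟨b, hb⟩⁻¹) * ⟨g₀, hg₀⟩⁻¹ := Subtype.ext rfl
    rw [he]
    have hc : (⟨a, ha⟩ * ⟨b, hb⟩ * ⟨a, ha⟩⁻¹ * ⟨b, hb⟩⁻¹ : ↥Δ) ∈ commutator ↥Δ := by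
      rw [commutator_def]
      exact Subgroup.commutator_mem_commutator (Subgroup.mem_top _) (Subgroup.mem_top _)
    exact (inferInstance : (commutator ↥Δ).Normal).conj_mem _ hc _
  have hwGH : wG ∈ H := by rw [hHdef, Subgroup.mem_subgroupOf]; exact hw₀N
  have hfixq : ∀ q : ↥Δ ⧸ H, wG • q = q := by
    intro q
    induction q using QuotientGroup.induction_on with
    | H x =>
      rw [MulAction.Quotient.smul_coe, smul_eq_mul, QuotientGroup.eq]
      have h := hHn.conj_mem _ (H.inv_mem hwGH) x⁻¹
      rw [inv_inv] at h
      simpa [mul_assoc] using h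
  -- the transfer: `∏_q ϕ(s_q⁻¹ w₀ s_q) = V(w₀) = 1` in `Δ_X̲^{ab}`
  let eH : ↥H ≃* ↥N := Subgroup.subgroupOfEquivOfLe hNΔ
  let ϕ : ↥H →* Abelianization ↥N := Abelianization.of.comp eH.toMonoidHom
  let T : H.LeftTransversal := ⟨Set.range Quotient.out, Subgroup.isComplement_range_left Quotient.out_eq'⟩
  have hT : ∀ q : ↥Δ ⧸ H, (T.2.leftQuotientEquiv q : ↥Δ) = q.out := fun q =>
    Subgroup.IsComplement.leftQuotientEquiv_apply Quotient.out_eq' q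
  have htransfer : (∏ q : ↥Δ ⧸ H, ϕ ⟨(T.2.leftQuotientEquiv q : ↥Δ)⁻¹ * wG * T.2.leftQuotientEquiv q,
      inv_mul_mul_mem_of_forall_smul_eq hfixq _⟩) = 1 := by
    rw [← transfer_eq_prod_conj ϕ T hfixq]
    exact (MonoidHom.mem_ker).mp (Abelianization.commutator_subset_ker _ hwGcomm)
  let S : ↥Δ ⧸ H → D.PiC := fun q => ((q.out : ↥Δ) : D.PiC)
  have hSΔ : ∀ q, S q ∈ Δ := fun q => (q.out : ↥Δ).2
  have hSX : ∀ q, S q ∈ D.PiX := fun q => (hSΔ q).1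
  have hdec : ∀ q : ↥Δ ⧸ H, ∃ t ∈ D.PiXbar,
      MulAut.conj (t * (S q)⁻¹) • D.decomp D.ε0 = D.decomp (C.act (S q)⁻¹ D.ε0) := fun q => C.act_decomp _ _
  choose t ht htdec using hdec
  -- `x_q := s_q⁻¹ · ε⁰`, `c_q := t_q s_q⁻¹`, `y_q := c_q w₀ c_q⁻¹`
  let x : ↥Δ ⧸ H → D.Cusp := fun q => C.act (S q)⁻¹ D.ε0
  let cc : ↥Δ ⧸ H → D.PiC := fun q => t q * (S q)⁻¹
  let y : ↥Δ ⧸ H → D.PiC := fun q => cc q * w₀ * (cc q)⁻¹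
  have hyI : ∀ q, y q ∈ D.inertia (x q) := by
    intro q
    refine Subgroup.mem_inf.mpr ⟨?_, D.E.normal_geom.conj_mem w₀ (Subgroup.mem_inf.mp hw₀I).2 (cc q)⟩
    have hmem : MulAut.conj (cc q) • w₀ ∈ MulAut.conj (cc q) • D.decomp D.ε0 :=
      Subgroup.smul_mem_pointwise_smul _ _ _ (Subgroup.mem_inf.mp hw₀I).1
    rw [htdec q, MulAut.smul_def, MulAut.conj_apply] at hmem
    exact hmem
  have hyN : ∀ q, y q ∈ N := fun q => D.inertia_le_deltaXbar _ (hyI q)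
  have hIgen : ∀ q, D.inertia (x q) ≤ (Subgroup.zpowers (y q)).topologicalClosure := by
    intro q u hu
    have huD : u ∈ D.decomp (x q) := (Subgroup.mem_inf.mp hu).1
    have huC : u ∈ D.DeltaC := (Subgroup.mem_inf.mp hu).2
    rw [← htdec q, Subgroup.mem_pointwise_smul_iff_inv_smul_mem, ← map_inv, MulAut.smul_def,
      MulAut.conj_apply] at huD
    have hvC : (cc q)⁻¹ * u * (cc q)⁻¹⁻¹ ∈ D.DeltaC := D.E.normal_geom.conj_mem u huC (cc q)⁻¹
    have hvI : (cc q)⁻¹ * u * (cc q)⁻¹⁻¹ ∈ D.inertia D.ε0 := Subgroup.mem_inf.mpr ⟨huD, hvC⟩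
    rw [hI0] at hvI
    have hu' : u = cc q * ((cc q)⁻¹ * u * (cc q)⁻¹⁻¹) * (cc q)⁻¹ := by group
    rw [hu']
    exact conj_mem_closure_zpowers_conj (cc q) hvI
  -- `s_q⁻¹ w₀ s_q = [t_q⁻¹, y_q] · y_q` with `[t_q⁻¹, y_q] ∈ Ker` by (L4)
  let m : ↥Δ ⧸ H → D.PiC := fun q => (t q)⁻¹ * y q * (t q)⁻¹⁻¹ * (y q)⁻¹
  have hm : ∀ q, m q ∈ D.modLKer := fun q => hL4 (x q) (t q)⁻¹ (D.PiXbar.inv_mem (ht q)) (y q) (hyI q)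
  have hmN : ∀ q, m q ∈ N := fun q => D.deltaEpsKer_le_deltaXbar (D.modLKer_le_deltaEpsKer (hm q))
  have hconj : ∀ q, (S q)⁻¹ * w₀ * S q = m q * y q := by
    intro q
    simp only [m, y, cc]
    group
  -- the transfer identity read in `Δ_X̲^{ab}`: `∏_q of(m_q) · of(y_q) = 1`
  let ofN : ∀ p : D.PiC, p ∈ N → Abelianization ↥N := fun p hp => Abelianization.of (⟨p, hp⟩ : ↥N)
  have hϕ : ∀ q : ↥Δ ⧸ H, ϕ ⟨(T.2.leftQuotientEquiv q : ↥Δ)⁻¹ * wG * T.2.leftQuotientEquiv q,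
      inv_mul_mul_mem_of_forall_smul_eq hfixq _⟩ = ofN (m q) (hmN q) * ofN (y q) (hyN q) := by
    intro q
    have h1 : ϕ ⟨(T.2.leftQuotientEquiv q : ↥Δ)⁻¹ * wG * T.2.leftQuotientEquiv q,
        inv_mul_mul_mem_of_forall_smul_eq hfixq _⟩ = ofN ((S q)⁻¹ * w₀ * S q) (by rw [hconj]; exact N.mul_mem (hmN q) (hyN q)) := by
      change Abelianization.of (eH _) = Abelianization.of _
      congr 1
      apply Subtype.ext
      change (((T.2.leftQuotientEquiv q : ↥Δ)⁻¹ * wG * T.2.leftQuotientEquiv q : ↥Δ) : D.PiC) = (S q)⁻¹ * w₀ * S q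
      rw [hT]
      rfl
    rw [h1]
    change Abelianization.of _ = Abelianization.of _ * Abelianization.of _
    rw [← map_mul]
    congr 1
    exact Subtype.ext (hconj q)
  have hprod1 : (∏ q : ↥Δ ⧸ H, ofN (m q) (hmN q)) * (∏ q : ↥Δ ⧸ H, ofN (y q) (hyN q)) = 1 := by
    rw [← Finset.prod_mul_distrib, ← htransfer]
    exact Finset.prod_congr rfl fun q _ => (hϕ q).symm
  -- images `T̄ := of(T)` in `Δ_X̲^{ab}` of subgroups `Ker(Δ_X̲ ↠ Δ_X̲^{ab} ⊗ ℤ/l) ≤ T ≤ Δ_X̲`, and membership both ways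
  have hT_of : ∀ (T' : Subgroup D.PiC) (p : D.PiC) (hp : p ∈ N), p ∈ T' →
      ofN p hp ∈ (T'.subgroupOf N).map Abelianization.of := fun T' p hp hpK =>
    Subgroup.mem_map_of_mem _ (by rw [Subgroup.mem_subgroupOf]; exact hpK)
  have hT_back : ∀ (T' : Subgroup D.PiC), D.modLKer ≤ T' → ∀ (p : D.PiC) (hp : p ∈ N),
      ofN p hp ∈ (T'.subgroupOf N).map Abelianization.of → p ∈ T' := by
    intro T' hMT p hp h
    have hker : (Abelianization.of : ↥N →* Abelianization ↥N).ker ≤ T'.subgroupOf N := by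
      rw [Abelianization.ker_of]
      intro v hv
      rw [Subgroup.mem_subgroupOf]
      refine hMT (Subgroup.le_topologicalClosure _ (Subgroup.mem_sup_left ?_))
      have hmap : (commutator ↥N).map N.subtype = ⁅N, N⁆ := by
        rw [commutator_def, Subgroup.map_commutator, ← MonoidHom.range_eq_map, Subgroup.range_subtype]
      rw [← hmap]
      exact ⟨v, hv, rfl⟩
    have h' : (⟨p, hp⟩ : ↥N) ∈ (((T'.subgroupOf N).map Abelianization.of).comap Abelianization.of) := h
    rwa [Subgroup.comap_map_eq_self hker, Subgroup.mem_subgroupOf] at h'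
  set Kbar : Subgroup (Abelianization ↥N) := (D.deltaEpsKer.subgroupOf N).map Abelianization.of with hKbar
  have hKbar_of : ∀ (p : D.PiC) (hp : p ∈ N), p ∈ D.deltaEpsKer → ofN p hp ∈ Kbar := hT_of D.deltaEpsKer
  have hKbar_back : ∀ (p : D.PiC) (hp : p ∈ N), ofN p hp ∈ Kbar → p ∈ D.deltaEpsKer :=
    hT_back D.deltaEpsKer D.modLKer_le_deltaEpsKer
  have hmK : ∀ q, ofN (m q) (hmN q) ∈ Kbar := fun q => hKbar_of _ _ (D.modLKer_le_deltaEpsKer (hm q))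
  have hyK : ∀ q, x q ≠ D.ε0 → x q ≠ D.ε1 → x q ≠ D.ε2 → ofN (y q) (hyN q) ∈ Kbar := by
    intro q h0 h1 h2
    refine hKbar_of _ _ (Subgroup.mem_sup_right ?_)
    exact le_iSup (fun z : {z : D.Cusp // D.IsNonzeroCusp z ∧ z ≠ D.ε1 ∧ z ≠ D.ε2} => D.inertia z.1)
      ⟨x q, h0, h1, h2⟩ (hyI q)
  have hprodY : (∏ q : ↥Δ ⧸ H, ofN (y q) (hyN q)) ∈ Kbar := by
    rw [eq_inv_of_mul_eq_one_right hprod1]; exact Kbar.inv_mem (Subgroup.prod_mem _ fun q _ => hmK q)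
  -- the orbit map `q ↦ x_q` is a bijection `Δ_X/Δ_X̲ ⥲ Cusp(X̲)`
  have hxinj : Function.Injective x := by
    intro q r hqr
    have hfix : C.act (S r * (S q)⁻¹) D.ε0 = D.ε0 := by
      have h : C.act (S r) (C.act (S q)⁻¹ D.ε0) = C.act (S r) (C.act (S r)⁻¹ D.ε0) := by
        change C.act (S r) (x q) = C.act (S r) (x r); rw [hqr]
      rwa [← Equiv.Perm.mul_apply, ← map_mul, ← Equiv.Perm.mul_apply, ← map_mul, mul_inv_cancel, map_one,
        Equiv.Perm.one_apply] at h
    have hX : S r * (S q)⁻¹ ∈ D.PiXbar := C.free _ (D.PiX.mul_mem (hSX r) (D.PiX.inv_mem (hSX q))) _ hfix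
    have hN' : S r * (S q)⁻¹ ∈ N := ⟨hX, (Δ.mul_mem (hSΔ r) (Δ.inv_mem (hSΔ q))).2⟩
    have hH' : (r.out : ↥Δ) * (q.out : ↥Δ)⁻¹ ∈ H :=
      Subgroup.mem_subgroupOf.mpr (by rw [Subgroup.coe_mul, Subgroup.coe_inv]; exact hN')
    have hH'' : (q.out : ↥Δ)⁻¹ * (r.out : ↥Δ) ∈ H := by
      have h := hHn.conj_mem _ hH' (q.out : ↥Δ)⁻¹
      simpa [mul_assoc] using h
    have h := QuotientGroup.eq.mpr hH''
    rwa [QuotientGroup.out_eq', QuotientGroup.out_eq'] at h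
  have hxsurj : Function.Surjective x := by
    intro c
    obtain ⟨g, hg, hgc⟩ := C.transitive D.ε0 c
    have hg' : g ∈ ((D.PiXbar ⊔ Δ : Subgroup D.PiC) : Set D.PiC) := by
      rw [← D.piX_eq_piXbar_sup_deltaX]; exact hg
    rw [Subgroup.normal_mul] at hg'
    obtain ⟨p, hp, d, hd, hpd⟩ := Set.mem_mul.mp hg'
    have hactd : C.act d D.ε0 = c := by
      have h : C.act g = C.act d := by
        rw [← hpd, map_mul, C.act_eq_one_of_mem_PiXbar hp, one_mul]
      rw [← h]; exact hgc
    let dG : ↥Δ := ⟨d, hd⟩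
    refine ⟨((dG⁻¹ : ↥Δ) : ↥Δ ⧸ H), ?_⟩
    obtain ⟨h, hh⟩ := QuotientGroup.mk_out_eq_mul H (dG⁻¹)
    change C.act (S _)⁻¹ D.ε0 = c
    have hS' : S ((dG⁻¹ : ↥Δ) : ↥Δ ⧸ H) = d⁻¹ * ((h : ↥Δ) : D.PiC) := by
      change (((((dG⁻¹ : ↥Δ) : ↥Δ ⧸ H)).out : ↥Δ) : D.PiC) = _
      rw [hh]; rfl
    have hhX : ((h : ↥Δ) : D.PiC) ∈ D.PiXbar := D.deltaXbar_le_piXbar (Subgroup.mem_subgroupOf.mp h.2)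
    rw [hS', mul_inv_rev, inv_inv, map_mul, C.act_eq_one_of_mem_PiXbar (D.PiXbar.inv_mem hhX), one_mul]
    exact hactd
  obtain ⟨q0, hq0⟩ := hxsurj D.ε0
  obtain ⟨q1, hq1⟩ := hxsurj D.ε1
  obtain ⟨q2, hq2⟩ := hxsurj D.ε2
  have h10 : q1 ≠ q0 := fun h => D.ε1_ne_ε0 (by rw [← hq1, ← hq0, h])
  have h20 : q2 ≠ q0 := fun h => D.ε2_ne_ε0 (by rw [← hq2, ← hq0, h])
  have h21 : q2 ≠ q1 := fun h => D.ε1_ne_ε2 (by rw [← hq2, ← hq1, h])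
  set f : ↥Δ ⧸ H → Abelianization ↥N := fun q => ofN (y q) (hyN q) with hf
  set R : Finset (↥Δ ⧸ H) := ((Finset.univ.erase q0).erase q1).erase q2 with hR
  have hsplit : (∏ q : ↥Δ ⧸ H, f q) = f q0 * (f q1 * (f q2 * ∏ q ∈ R, f q)) := by
    rw [← Finset.mul_prod_erase Finset.univ f (Finset.mem_univ q0),
      ← Finset.mul_prod_erase _ f (Finset.mem_erase.mpr ⟨h10, Finset.mem_univ q1⟩),
      ← Finset.mul_prod_erase _ f (Finset.mem_erase.mpr ⟨h21, Finset.mem_erase.mpr ⟨h20, Finset.mem_univ q2⟩⟩)]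
  have hR_mem : (∏ q ∈ R, f q) ∈ Kbar := by
    refine Subgroup.prod_mem _ fun q hq => ?_
    simp only [hR, Finset.mem_erase] at hq
    obtain ⟨hq2', hq1', hq0', -⟩ := hq
    exact hyK q (fun h => hq0' (hxinj (h.trans hq0.symm))) (fun h => hq1' (hxinj (h.trans hq1.symm)))
      (fun h => hq2' (hxinj (h.trans hq2.symm)))
  have h3 : f q0 * f q1 * f q2 ∈ Kbar := by
    have he : f q0 * f q1 * f q2 = (∏ q : ↥Δ ⧸ H, f q) * (∏ q ∈ R, f q)⁻¹ := by
      rw [hsplit]; simp only [mul_assoc, mul_inv_cancel, mul_one]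
    rw [he]; exact Kbar.mul_mem hprodY (Kbar.inv_mem hR_mem)
  -- the relation at `ε⁰` alone: `of(y_{q0}) ∈ T̄`, `T := Ker · ∏_{x ≠ ε⁰} I_x`
  set T' : Subgroup D.PiC := D.modLKer ⊔ ⨆ (x : {x : D.Cusp // x ≠ D.ε0}), D.inertia x.1 with hT'
  have hMT' : D.modLKer ≤ T' := le_sup_left
  have hyT' : ∀ q, q ≠ q0 → f q ∈ (T'.subgroupOf N).map Abelianization.of := by
    intro q hq
    refine hT_of T' _ _ (Subgroup.mem_sup_right ?_)
    exact le_iSup (fun z : {z : D.Cusp // z ≠ D.ε0} => D.inertia z.1)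
      ⟨x q, fun h => hq (hxinj (h.trans hq0.symm))⟩ (hyI q)
  have hrel : f q0 ∈ (T'.subgroupOf N).map Abelianization.of := by
    have he : f q0 = ((∏ q : ↥Δ ⧸ H, ofN (m q) (hmN q)) * ∏ q ∈ Finset.univ.erase q0, f q)⁻¹ := by
      rw [← Finset.mul_prod_erase Finset.univ f (Finset.mem_univ q0), ← mul_assoc,
        mul_comm (∏ q : ↥Δ ⧸ H, ofN (m q) (hmN q)) (f q0), mul_assoc] at hprod1
      exact eq_inv_of_mul_eq_one_left hprod1
    rw [he]
    refine Subgroup.inv_mem _ (Subgroup.mul_mem _ (Subgroup.prod_mem _ fun q _ => hT_of T' _ _ (hMT' (hm q)))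
      (Subgroup.prod_mem _ fun q hq => hyT' q (Finset.ne_of_mem_erase hq)))
  refine ⟨y q0, hq0 ▸ hyI q0, y q1, hq1 ▸ hyI q1, y q2, hq2 ▸ hyI q2, ⟨hq0 ▸ hIgen q0, hq1 ▸ hIgen q1⟩, ?_,
    hT_back T' hMT' _ (hyN q0) hrel⟩
  refine hKbar_back _ (N.mul_mem (N.mul_mem (hyN q0) (hyN q1)) (hyN q2)) ?_
  have he : ofN (y q0 * y q1 * y q2) (N.mul_mem (N.mul_mem (hyN q0) (hyN q1)) (hyN q2)) = f q0 * f q1 * f q2 := by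
    change Abelianization.of _ = Abelianization.of _ * Abelianization.of _ * Abelianization.of _
    rw [← map_mul, ← map_mul]; rfl
  rw [he]; exact h3

include C in
/-- **The oriented product relation (O1) at `ε⁰, ε′, ε″`** (the binder `hprod` of p499258, VERBATIM), from (c′) at `ε⁰`,
(L4) and the cusp action — by the transfer `Δ_X → Δ_X̲^{ab}`. ([IUTchI] §1 p.38, Cor 1.2 p.39) [claim: Mochizuki2012, status: disputed] -/
theorem exists_orientedProduct_of_commutatorCusp
    (hI0 : ∃ g ∈ D.PiX ⊓ D.DeltaC, ∃ a ∈ D.PiX ⊓ D.DeltaC, ∃ b ∈ D.PiX ⊓ D.DeltaC,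
      D.inertia D.ε0 = (Subgroup.zpowers (g * (a * b * a⁻¹ * b⁻¹) * g⁻¹)).topologicalClosure)
    (hL4 : ∀ x : D.Cusp, ∀ g ∈ D.PiXbar, ∀ z ∈ D.inertia x, g * z * g⁻¹ * z⁻¹ ∈ D.modLKer) :
    ∃ z₀ ∈ D.inertia D.ε0, ∃ z₁ ∈ D.inertia D.ε1, ∃ z₂ ∈ D.inertia D.ε2,
      D.inertia D.ε1 ≤ (Subgroup.zpowers z₁).topologicalClosure ∧ z₀ * z₁ * z₂ ∈ D.deltaEpsKer := by
  obtain ⟨z₀, hz₀, z₁, hz₁, z₂, hz₂, ⟨-, hgen₁⟩, hprod, -⟩ := C.exists_orientedGenerators_of_commutatorCusp hI0 hL4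
  exact ⟨z₀, hz₀, z₁, hz₁, z₂, hz₂, hgen₁, hprod⟩

include C in
/-- **The surface relation read at the zero cusp** («(REL′)», the binder `hrel` of abc-iut-L5-t1's «COR12-CS-OF-REL» VERBATIM):
under (L0) `[Δ_X̲ : Ker(Δ_X̲ ↠ Δ_X̲^{ab} ⊗ ℤ/l)] ≠ 0`, (c′) at `ε⁰` and (L4), `I_{ε⁰} ≤ I_{ε′} · I_{ε″} · Ker(Δ_X̲ ↠ Δ_ε)` — the
zero-cusp line lies in the span of the other cusp lines, the image of `[α, β] · ∏_c γ_c = 1` in `H₁(X̲; ℤ/l)`.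
([IUTchI] §1 p.38) [claim: Mochizuki2012, status: disputed] -/
theorem inertia_ε0_le_span_of_commutatorCusp
    (hI0 : ∃ g ∈ D.PiX ⊓ D.DeltaC, ∃ a ∈ D.PiX ⊓ D.DeltaC, ∃ b ∈ D.PiX ⊓ D.DeltaC,
      D.inertia D.ε0 = (Subgroup.zpowers (g * (a * b * a⁻¹ * b⁻¹) * g⁻¹)).topologicalClosure)
    (hL4 : ∀ x : D.Cusp, ∀ g ∈ D.PiXbar, ∀ z ∈ D.inertia x, g * z * g⁻¹ * z⁻¹ ∈ D.modLKer)
    (hL0 : D.modLKer.relIndex D.DeltaXbar ≠ 0) :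
    D.inertia D.ε0 ≤ D.inertia D.ε1 ⊔ D.inertia D.ε2 ⊔ D.deltaEpsKer := by
  obtain ⟨z₀, hz₀, z₁, hz₁, z₂, hz₂, ⟨hgen₀, -⟩, hprod, -⟩ := C.exists_orientedGenerators_of_commutatorCusp hI0 hL4
  have hN : D.inertia D.ε1 ⊔ D.inertia D.ε2 ⊔ D.deltaEpsKer ≤ D.DeltaXbar :=
    sup_le (sup_le (D.inertia_le_deltaXbar _) (D.inertia_le_deltaXbar _)) D.deltaEpsKer_le_deltaXbar
  have hz₀N : z₀ ∈ D.inertia D.ε1 ⊔ D.inertia D.ε2 ⊔ D.deltaEpsKer := by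
    have he : z₀ = (z₀ * z₁ * z₂) * z₂⁻¹ * z₁⁻¹ := by group
    rw [he]
    exact Subgroup.mul_mem _ (Subgroup.mul_mem _ (Subgroup.mem_sup_right hprod)
      (Subgroup.mem_sup_left (Subgroup.mem_sup_right (Subgroup.inv_mem _ hz₂))))
      (Subgroup.mem_sup_left (Subgroup.mem_sup_left (Subgroup.inv_mem _ hz₁)))
  refine (D.le_zpowers_sup_of_le_closure hL0 (D.modLKer_le_deltaEpsKer.trans le_sup_right) hN
    (D.inertia_le_deltaXbar _ hz₀) hgen₀).trans ?_
  exact sup_le (Subgroup.zpowers_le.mpr hz₀N) le_rfl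

end CuspGalois

/-- **(O1) over the origin record**: for `O : D.GeomOrigin` ((A)+(c′)) and the cusp action `C`, the oriented product
relation at `ε⁰, ε′, ε″` holds — (L4) being a theorem of (∗) + `O` + `C` (abc-iut-w4-d051's `GeomOrigin.inertia_central`,
p501910, over abc-iut-L5-t1's p500241). ([IUTchI] §1 p.38, Cor 1.2 p.39) [claim: Mochizuki2012, status: disputed] -/
theorem GeomOrigin.exists_orientedProduct (O : D.GeomOrigin) (C : D.CuspGalois) :
    ∃ z₀ ∈ D.inertia D.ε0, ∃ z₁ ∈ D.inertia D.ε1, ∃ z₂ ∈ D.inertia D.ε2,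
      D.inertia D.ε1 ≤ (Subgroup.zpowers z₁).topologicalClosure ∧ z₀ * z₁ * z₂ ∈ D.deltaEpsKer := by
  obtain ⟨g, hg, hI⟩ := O.inertia_eq_conj_commutator D.ε0
  exact C.exists_orientedProduct_of_commutatorCusp ⟨g, hg, _, (O.gens 0).2, _, (O.gens 1).2, hI⟩
    (O.inertia_central C)

/-- **(REL′) over the origin record**: for `O : D.GeomOrigin` and the cusp action `C`, `I_{ε⁰} ≤ I_{ε′} · I_{ε″} · Ker(Δ_X̲ ↠ Δ_ε)`
— (L0) from (A) (abc-iut-f-090's `modLKer_relIndex_ne_zero_of_isFreeProOn`), (L4) from (∗) + `O` + `C` (p501910).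
([IUTchI] §1 p.38) [claim: Mochizuki2012, status: disputed] -/
theorem GeomOrigin.inertia_ε0_le_span (O : D.GeomOrigin) (C : D.CuspGalois) :
    D.inertia D.ε0 ≤ D.inertia D.ε1 ⊔ D.inertia D.ε2 ⊔ D.deltaEpsKer := by
  obtain ⟨g, hg, hI⟩ := O.inertia_eq_conj_commutator D.ε0
  exact C.inertia_ε0_le_span_of_commutatorCusp ⟨g, hg, _, (O.gens 0).2, _, (O.gens 1).2, hI⟩
    (O.inertia_central C) (D.modLKer_relIndex_ne_zero_of_isFreeProOn O.isFreeProOn)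

end PuncturedEllipticData

end Literature.IUT.HodgeTheaters

end
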